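import Summits.CriticalPhenomena.PercolationContinuityZ3.Theorems.PercNearOneGluingNoHeavyLowerTailAntipodalR1TwoCut
import Summits.CriticalPhenomena.PercolationContinuityZ3.Theorems.PercNearOneGluingNoHeavyLowerTailAntipodalR1TwoCutComponents
import HarnessLib

/-!
# ANTI₁ across a 2-separation, VII: grades across the separator

Support file for `stmt-CriticalPhenomena-4575` (memo `prim-gen-kcluster/KCLUSTER-gen76.md` §2, graded
form; conjecture ANTI₁-GRADED of `KCLUSTER-gen52.md` §3 — the form that implies the refined row R1 for the
random-cluster measures with `q ≥ 1`).  No definitions, no named facts, no sorries.  Vocabulary of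
`AntipodalR1` (gen 62); grades as in `…AntipodalR1NestedGraded`: the GRADE of a colouring `x` of
`ends : ι → Sym2 V` (vertex type `V` finite) is
`g(x) = #CC(fromEdgeSet {s | ∃ e, x e = true ∧ ends e = s}) + #CC(fromEdgeSet {s | ∃ e, x e = false ∧ ends e = s})`,
and ANTI₁-GRADED is `#{x ∈ L : g(x) = t} ≤ #{x ∈ R(b,c) : g(x) = t}` for every `t`.

This file: the GRADE SHIFT across the separator.  By part VI, for the glued system `G` and the gadget
system `G'` with the same state, `g_G(ω₁ ⊕ ω₂) + 2·#I = g_{G'}(ω₁ ⊕ gadget) + c(ω₂)` (`grade_glued_eq`,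
`grade_glued_eq_inl`), where `I` is the set of interior vertices of `G₂` and `c(ω₂)` — the number of
one-coloured clusters of `G₂` made of interior vertices — depends only on `ω₂` and is invariant under the
colour swap (`card_ccInside_flip_add`).  Consequently the fibrewise embeddings of part III respect the
grade up to that shift (`card_fibre_lSet_grade_le_gadget`, `card_gadget_rSet_grade_le_fibre`,
`card_fibre_lSet_grade_le_inl`, `card_rSet_inl_grade_le_fibre`), and a level-by-level inequality
survives a constant shift (`card_filter_add_le`).  The graded 2-cut reduction itself is part VIII.
[this work]
-/

namespace Summit.CriticalPhenomena.PercolationContinuityZ3.Theorems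

namespace AntipodalR1

open Finset Relation SimpleGraph

variable {V ι₁ ι₂ : Type*}

section Shift

/-- Level sets shifted by a constant: a level-by-level inequality survives the shift `g ↦ g + k`.
[this work] -/
theorem card_filter_add_le {α : Type*} [Fintype α] (P Q : α → Prop) [DecidablePred P]
    [DecidablePred Q] (g g' : α → ℕ)
    (h : ∀ t, (univ.filter fun x => P x ∧ g x = t).card ≤ (univ.filter fun x => Q x ∧ g' x = t).card)
    (k T : ℕ) :
    (univ.filter fun x => P x ∧ g x + k = T).card ≤ (univ.filter fun x => Q x ∧ g' x + k = T).card := by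
  by_cases hk : k ≤ T
  · have e1 : (univ.filter fun x => P x ∧ g x + k = T) = univ.filter fun x => P x ∧ g x = T - k :=
      filter_congr fun x _ => by constructor <;> rintro ⟨h1, h2⟩ <;> exact ⟨h1, by omega⟩
    have e2 : (univ.filter fun x => Q x ∧ g' x + k = T) = univ.filter fun x => Q x ∧ g' x = T - k :=
      filter_congr fun x _ => by constructor <;> rintro ⟨h1, h2⟩ <;> exact ⟨h1, by omega⟩
    rw [e1, e2]; exact h _
  · have e1 : (univ.filter fun x => P x ∧ g x + k = T) = ∅ :=
      filter_eq_empty_iff.2 fun x _ hx => by omega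
    rw [e1, card_empty]; exact Nat.zero_le _

end Shift

section Grades

variable {ends₁ : ι₁ → Sym2 V} {ends₂ : ι₂ → Sym2 V} {u v a b c : V}
variable [Fintype V] [Fintype ι₁] [DecidableEq ι₁] [Fintype ι₂] [DecidableEq ι₂]

omit [Fintype ι₁] [DecidableEq ι₁] [Fintype ι₂] [DecidableEq ι₂] in
/-- **Grade shift (gadget).**  For the glued system and a gadget colouring with the same state:
`g_G(ω₁ ⊕ ω₂) + 2·#I = g_{G'}(ω₁ ⊕ g) + c_true(ω₂) + c_false(ω₂)`. [this work] -/
theorem grade_glued_eq {κ : Type*} [Fintype κ] [DecidableEq κ]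
    (hsep : ∀ w i, w ∈ ends₁ i → ∀ j, w ∈ ends₂ j → w = u ∨ w = v) (ω₁ : ι₁ → Bool) (ω₂ : ι₂ → Bool)
    (g : κ → Bool) (hst : ∀ col, v ∈ clus ends₂ ω₂ col u ↔ (u = v ∨ ∃ k, g k = col)) :
    (Nat.card (fromEdgeSet {s : Sym2 V | ∃ e, Sum.elim ω₁ ω₂ e = true ∧
        Sum.elim ends₁ ends₂ e = s}).ConnectedComponent +
      Nat.card (fromEdgeSet {s : Sym2 V | ∃ e, Sum.elim ω₁ ω₂ e = false ∧
        Sum.elim ends₁ ends₂ e = s}).ConnectedComponent) +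
      2 * Nat.card {w : V | ¬ ∀ j, w ∈ ends₂ j → w = u ∨ w = v} =
    (Nat.card (fromEdgeSet {s : Sym2 V | ∃ e, Sum.elim ω₁ g e = true ∧
        Sum.elim ends₁ (fun _ : κ => s(u, v)) e = s}).ConnectedComponent +
      Nat.card (fromEdgeSet {s : Sym2 V | ∃ e, Sum.elim ω₁ g e = false ∧
        Sum.elim ends₁ (fun _ : κ => s(u, v)) e = s}).ConnectedComponent) +
      (Nat.card {D : (fromEdgeSet {s : Sym2 V | ∃ j, ω₂ j = true ∧ ends₂ j = s}).ConnectedComponent //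
          ¬ ∃ x, x ∉ {w : V | ¬ ∀ j, w ∈ ends₂ j → w = u ∨ w = v} ∧
            (fromEdgeSet {s : Sym2 V | ∃ j, ω₂ j = true ∧ ends₂ j = s}).connectedComponentMk x = D} +
        Nat.card {D : (fromEdgeSet {s : Sym2 V | ∃ j, ω₂ j = false ∧ ends₂ j = s}).ConnectedComponent //
          ¬ ∃ x, x ∉ {w : V | ¬ ∀ j, w ∈ ends₂ j → w = u ∨ w = v} ∧
            (fromEdgeSet {s : Sym2 V | ∃ j, ω₂ j = false ∧ ends₂ j = s}).connectedComponentMk x = D}) := by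
  have h1 := card_cc_glued_add_eq (ω := Sum.elim ω₁ ω₂) (ω' := Sum.elim ω₁ g) hsep (fun _ => rfl) hst true
  have h2 := card_cc_glued_add_eq (ω := Sum.elim ω₁ ω₂) (ω' := Sum.elim ω₁ g) hsep (fun _ => rfl) hst false
  simp only [Sum.elim_inr] at h1 h2
  omega

omit [Fintype ι₁] [DecidableEq ι₁] [Fintype ι₂] [DecidableEq ι₂] in
/-- **Grade shift (bare side).**  If `u, v` are joined inside `G₂` by neither colour:
`g_G(ω₁ ⊕ ω₂) + 2·#I = g_{G₁}(ω₁) + c_true(ω₂) + c_false(ω₂)`. [this work] -/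
theorem grade_glued_eq_inl
    (hsep : ∀ w i, w ∈ ends₁ i → ∀ j, w ∈ ends₂ j → w = u ∨ w = v) (ω₁ : ι₁ → Bool) (ω₂ : ι₂ → Bool)
    (hO : v ∉ clus ends₂ ω₂ true u) (hK : v ∉ clus ends₂ ω₂ false u) :
    (Nat.card (fromEdgeSet {s : Sym2 V | ∃ e, Sum.elim ω₁ ω₂ e = true ∧
        Sum.elim ends₁ ends₂ e = s}).ConnectedComponent +
      Nat.card (fromEdgeSet {s : Sym2 V | ∃ e, Sum.elim ω₁ ω₂ e = false ∧
        Sum.elim ends₁ ends₂ e = s}).ConnectedComponent) +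
      2 * Nat.card {w : V | ¬ ∀ j, w ∈ ends₂ j → w = u ∨ w = v} =
    (Nat.card (fromEdgeSet {s : Sym2 V | ∃ e, ω₁ e = true ∧ ends₁ e = s}).ConnectedComponent +
      Nat.card (fromEdgeSet {s : Sym2 V | ∃ e, ω₁ e = false ∧ ends₁ e = s}).ConnectedComponent) +
      (Nat.card {D : (fromEdgeSet {s : Sym2 V | ∃ j, ω₂ j = true ∧ ends₂ j = s}).ConnectedComponent //
          ¬ ∃ x, x ∉ {w : V | ¬ ∀ j, w ∈ ends₂ j → w = u ∨ w = v} ∧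
            (fromEdgeSet {s : Sym2 V | ∃ j, ω₂ j = true ∧ ends₂ j = s}).connectedComponentMk x = D} +
        Nat.card {D : (fromEdgeSet {s : Sym2 V | ∃ j, ω₂ j = false ∧ ends₂ j = s}).ConnectedComponent //
          ¬ ∃ x, x ∉ {w : V | ¬ ∀ j, w ∈ ends₂ j → w = u ∨ w = v} ∧
            (fromEdgeSet {s : Sym2 V | ∃ j, ω₂ j = false ∧ ends₂ j = s}).connectedComponentMk x = D}) := by
  have h1 := card_cc_glued_add_eq_inl (ω := Sum.elim ω₁ ω₂) hsep (col := true) hO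
  have h2 := card_cc_glued_add_eq_inl (ω := Sum.elim ω₁ ω₂) hsep (col := false) hK
  simp only [Sum.elim_inr, Sum.elim_inl] at h1 h2
  omega

omit [Fintype V] [Fintype ι₁] [DecidableEq ι₁] [Fintype ι₂] [DecidableEq ι₂] in
/-- **Swap invariance of `c`.**  `c_true(ω̄₂) + c_false(ω̄₂) = c_true(ω₂) + c_false(ω₂)`. [this work] -/
theorem card_ccInside_flip_add (ω₂ : ι₂ → Bool) :
    Nat.card {D : (fromEdgeSet {s : Sym2 V | ∃ j, (!ω₂ j) = true ∧ ends₂ j = s}).ConnectedComponent //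
        ¬ ∃ x, x ∉ {w : V | ¬ ∀ j, w ∈ ends₂ j → w = u ∨ w = v} ∧
          (fromEdgeSet {s : Sym2 V | ∃ j, (!ω₂ j) = true ∧ ends₂ j = s}).connectedComponentMk x = D} +
      Nat.card {D : (fromEdgeSet {s : Sym2 V | ∃ j, (!ω₂ j) = false ∧ ends₂ j = s}).ConnectedComponent //
        ¬ ∃ x, x ∉ {w : V | ¬ ∀ j, w ∈ ends₂ j → w = u ∨ w = v} ∧
          (fromEdgeSet {s : Sym2 V | ∃ j, (!ω₂ j) = false ∧ ends₂ j = s}).connectedComponentMk x = D} =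
    Nat.card {D : (fromEdgeSet {s : Sym2 V | ∃ j, ω₂ j = true ∧ ends₂ j = s}).ConnectedComponent //
        ¬ ∃ x, x ∉ {w : V | ¬ ∀ j, w ∈ ends₂ j → w = u ∨ w = v} ∧
          (fromEdgeSet {s : Sym2 V | ∃ j, ω₂ j = true ∧ ends₂ j = s}).connectedComponentMk x = D} +
      Nat.card {D : (fromEdgeSet {s : Sym2 V | ∃ j, ω₂ j = false ∧ ends₂ j = s}).ConnectedComponent //
        ¬ ∃ x, x ∉ {w : V | ¬ ∀ j, w ∈ ends₂ j → w = u ∨ w = v} ∧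
          (fromEdgeSet {s : Sym2 V | ∃ j, ω₂ j = false ∧ ends₂ j = s}).connectedComponentMk x = D} := by
  have hT : (fromEdgeSet {s : Sym2 V | ∃ j, (!ω₂ j) = true ∧ ends₂ j = s}) =
      fromEdgeSet {s : Sym2 V | ∃ j, ω₂ j = false ∧ ends₂ j = s} := by
    simp
  have hF : (fromEdgeSet {s : Sym2 V | ∃ j, (!ω₂ j) = false ∧ ends₂ j = s}) =
      fromEdgeSet {s : Sym2 V | ∃ j, ω₂ j = true ∧ ends₂ j = s} := by
    simp
  rw [hT, hF, Nat.add_comm]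

/-! ### Graded fibrewise embeddings -/

/-- Graded form of `card_fibre_lSet_le_gadget`: an `L(G)`-fibre at level `t` embeds into the
`L`-fibre of the gadget system at the shifted level. [this work] -/
theorem card_fibre_lSet_grade_le_gadget {κ : Type*} [Fintype κ] [DecidableEq κ]
    (hsep : ∀ w i, w ∈ ends₁ i → ∀ j, w ∈ ends₂ j → w = u ∨ w = v)
    (ha : ∀ j, a ∈ ends₂ j → a = u ∨ a = v) (hb : ∀ j, b ∈ ends₂ j → b = u ∨ b = v)
    (hc : ∀ j, c ∈ ends₂ j → c = u ∨ c = v) (ω₂ : ι₂ → Bool) (g : κ → Bool)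
    (hst : ∀ col, v ∈ clus ends₂ ω₂ col u ↔ (u = v ∨ ∃ k, g k = col)) (t : ℕ) :
    (univ.filter fun ω₁ : ι₁ → Bool => Sum.elim ω₁ ω₂ ∈ lSet (Sum.elim ends₁ ends₂) a b c ∧
        Nat.card (fromEdgeSet {s : Sym2 V | ∃ e, Sum.elim ω₁ ω₂ e = true ∧
          Sum.elim ends₁ ends₂ e = s}).ConnectedComponent +
        Nat.card (fromEdgeSet {s : Sym2 V | ∃ e, Sum.elim ω₁ ω₂ e = false ∧
          Sum.elim ends₁ ends₂ e = s}).ConnectedComponent = t).card ≤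
    (univ.filter fun ω₁ : ι₁ → Bool =>
        Sum.elim ω₁ g ∈ lSet (Sum.elim ends₁ (fun _ : κ => s(u, v))) a b c ∧
        (Nat.card (fromEdgeSet {s : Sym2 V | ∃ e, Sum.elim ω₁ g e = true ∧
          Sum.elim ends₁ (fun _ : κ => s(u, v)) e = s}).ConnectedComponent +
        Nat.card (fromEdgeSet {s : Sym2 V | ∃ e, Sum.elim ω₁ g e = false ∧
          Sum.elim ends₁ (fun _ : κ => s(u, v)) e = s}).ConnectedComponent) +
        (Nat.card {D : (fromEdgeSet {s : Sym2 V | ∃ j, ω₂ j = true ∧ ends₂ j = s}).ConnectedComponent //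
            ¬ ∃ x, x ∉ {w : V | ¬ ∀ j, w ∈ ends₂ j → w = u ∨ w = v} ∧
              (fromEdgeSet {s : Sym2 V | ∃ j, ω₂ j = true ∧ ends₂ j = s}).connectedComponentMk x = D} +
          Nat.card {D : (fromEdgeSet {s : Sym2 V | ∃ j, ω₂ j = false ∧ ends₂ j = s}).ConnectedComponent //
            ¬ ∃ x, x ∉ {w : V | ¬ ∀ j, w ∈ ends₂ j → w = u ∨ w = v} ∧
              (fromEdgeSet {s : Sym2 V | ∃ j, ω₂ j = false ∧ ends₂ j = s}).connectedComponentMk x = D}) =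
        t + 2 * Nat.card {w : V | ¬ ∀ j, w ∈ ends₂ j → w = u ∨ w = v}).card := by
  classical
  refine card_le_card fun ω₁ h => ?_
  obtain ⟨hL, hg⟩ := (mem_filter.1 h).2
  refine mem_filter.2 ⟨mem_univ _, mem_lSet_gadget_of_mem_lSet (ω := Sum.elim ω₁ ω₂)
    (ω' := Sum.elim ω₁ g) hsep ha hb hc (fun _ => rfl) hst hL, ?_⟩
  have := grade_glued_eq hsep ω₁ ω₂ g hst
  omega

/-- Graded form of `card_gadget_rSet_le_fibre`. [this work] -/
theorem card_gadget_rSet_grade_le_fibre {κ : Type*} [Fintype κ] [DecidableEq κ]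
    (hsep : ∀ w i, w ∈ ends₁ i → ∀ j, w ∈ ends₂ j → w = u ∨ w = v)
    (ha : ∀ j, a ∈ ends₂ j → a = u ∨ a = v) (hb : ∀ j, b ∈ ends₂ j → b = u ∨ b = v)
    (hc : ∀ j, c ∈ ends₂ j → c = u ∨ c = v) (ω₂ : ι₂ → Bool) (g : κ → Bool)
    (hst : ∀ col, v ∈ clus ends₂ ω₂ col u ↔ (u = v ∨ ∃ k, g k = col)) (t : ℕ) :
    (univ.filter fun ω₁ : ι₁ → Bool =>
        Sum.elim ω₁ g ∈ rSet (Sum.elim ends₁ (fun _ : κ => s(u, v))) a b c ∧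
        (Nat.card (fromEdgeSet {s : Sym2 V | ∃ e, Sum.elim ω₁ g e = true ∧
          Sum.elim ends₁ (fun _ : κ => s(u, v)) e = s}).ConnectedComponent +
        Nat.card (fromEdgeSet {s : Sym2 V | ∃ e, Sum.elim ω₁ g e = false ∧
          Sum.elim ends₁ (fun _ : κ => s(u, v)) e = s}).ConnectedComponent) +
        (Nat.card {D : (fromEdgeSet {s : Sym2 V | ∃ j, ω₂ j = true ∧ ends₂ j = s}).ConnectedComponent //
            ¬ ∃ x, x ∉ {w : V | ¬ ∀ j, w ∈ ends₂ j → w = u ∨ w = v} ∧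
              (fromEdgeSet {s : Sym2 V | ∃ j, ω₂ j = true ∧ ends₂ j = s}).connectedComponentMk x = D} +
          Nat.card {D : (fromEdgeSet {s : Sym2 V | ∃ j, ω₂ j = false ∧ ends₂ j = s}).ConnectedComponent //
            ¬ ∃ x, x ∉ {w : V | ¬ ∀ j, w ∈ ends₂ j → w = u ∨ w = v} ∧
              (fromEdgeSet {s : Sym2 V | ∃ j, ω₂ j = false ∧ ends₂ j = s}).connectedComponentMk x = D}) =
        t + 2 * Nat.card {w : V | ¬ ∀ j, w ∈ ends₂ j → w = u ∨ w = v}).card ≤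
    (univ.filter fun ω₁ : ι₁ → Bool => Sum.elim ω₁ ω₂ ∈ rSet (Sum.elim ends₁ ends₂) a b c ∧
        Nat.card (fromEdgeSet {s : Sym2 V | ∃ e, Sum.elim ω₁ ω₂ e = true ∧
          Sum.elim ends₁ ends₂ e = s}).ConnectedComponent +
        Nat.card (fromEdgeSet {s : Sym2 V | ∃ e, Sum.elim ω₁ ω₂ e = false ∧
          Sum.elim ends₁ ends₂ e = s}).ConnectedComponent = t).card := by
  classical
  refine card_le_card fun ω₁ h => ?_
  obtain ⟨hR, hg⟩ := (mem_filter.1 h).2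
  refine mem_filter.2 ⟨mem_univ _, mem_rSet_of_mem_rSet_gadget (ω := Sum.elim ω₁ ω₂)
    (ω' := Sum.elim ω₁ g) hsep ha hb hc (fun _ => rfl) hst hR, ?_⟩
  have := grade_glued_eq hsep ω₁ ω₂ g hst
  omega

/-- Graded form of `card_fibre_lSet_le_inl`. [this work] -/
theorem card_fibre_lSet_grade_le_inl
    (hsep : ∀ w i, w ∈ ends₁ i → ∀ j, w ∈ ends₂ j → w = u ∨ w = v)
    (ha : ∀ j, a ∈ ends₂ j → a = u ∨ a = v) (hb : ∀ j, b ∈ ends₂ j → b = u ∨ b = v)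
    (hc : ∀ j, c ∈ ends₂ j → c = u ∨ c = v) (ω₂ : ι₂ → Bool)
    (hO : v ∉ clus ends₂ ω₂ true u) (hK : v ∉ clus ends₂ ω₂ false u) (t : ℕ) :
    (univ.filter fun ω₁ : ι₁ → Bool => Sum.elim ω₁ ω₂ ∈ lSet (Sum.elim ends₁ ends₂) a b c ∧
        Nat.card (fromEdgeSet {s : Sym2 V | ∃ e, Sum.elim ω₁ ω₂ e = true ∧
          Sum.elim ends₁ ends₂ e = s}).ConnectedComponent +
        Nat.card (fromEdgeSet {s : Sym2 V | ∃ e, Sum.elim ω₁ ω₂ e = false ∧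
          Sum.elim ends₁ ends₂ e = s}).ConnectedComponent = t).card ≤
    (univ.filter fun ω₁ : ι₁ → Bool => ω₁ ∈ lSet ends₁ a b c ∧
        (Nat.card (fromEdgeSet {s : Sym2 V | ∃ e, ω₁ e = true ∧ ends₁ e = s}).ConnectedComponent +
        Nat.card (fromEdgeSet {s : Sym2 V | ∃ e, ω₁ e = false ∧ ends₁ e = s}).ConnectedComponent) +
        (Nat.card {D : (fromEdgeSet {s : Sym2 V | ∃ j, ω₂ j = true ∧ ends₂ j = s}).ConnectedComponent //
            ¬ ∃ x, x ∉ {w : V | ¬ ∀ j, w ∈ ends₂ j → w = u ∨ w = v} ∧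
              (fromEdgeSet {s : Sym2 V | ∃ j, ω₂ j = true ∧ ends₂ j = s}).connectedComponentMk x = D} +
          Nat.card {D : (fromEdgeSet {s : Sym2 V | ∃ j, ω₂ j = false ∧ ends₂ j = s}).ConnectedComponent //
            ¬ ∃ x, x ∉ {w : V | ¬ ∀ j, w ∈ ends₂ j → w = u ∨ w = v} ∧
              (fromEdgeSet {s : Sym2 V | ∃ j, ω₂ j = false ∧ ends₂ j = s}).connectedComponentMk x = D}) =
        t + 2 * Nat.card {w : V | ¬ ∀ j, w ∈ ends₂ j → w = u ∨ w = v}).card := by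
  classical
  refine card_le_card fun ω₁ h => ?_
  obtain ⟨hL, hg⟩ := (mem_filter.1 h).2
  refine mem_filter.2 ⟨mem_univ _,
    mem_lSet_inl_of_mem_lSet (ω := Sum.elim ω₁ ω₂) hsep ha hb hc hO hK hL, ?_⟩
  have := grade_glued_eq_inl hsep ω₁ ω₂ hO hK
  omega

/-- Graded form of `card_rSet_inl_le_fibre`. [this work] -/
theorem card_rSet_inl_grade_le_fibre
    (hsep : ∀ w i, w ∈ ends₁ i → ∀ j, w ∈ ends₂ j → w = u ∨ w = v)
    (ha : ∀ j, a ∈ ends₂ j → a = u ∨ a = v) (hb : ∀ j, b ∈ ends₂ j → b = u ∨ b = v)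
    (hc : ∀ j, c ∈ ends₂ j → c = u ∨ c = v) (ω₂ : ι₂ → Bool)
    (hO : v ∉ clus ends₂ ω₂ true u) (hK : v ∉ clus ends₂ ω₂ false u) (t : ℕ) :
    (univ.filter fun ω₁ : ι₁ → Bool => ω₁ ∈ rSet ends₁ a b c ∧
        (Nat.card (fromEdgeSet {s : Sym2 V | ∃ e, ω₁ e = true ∧ ends₁ e = s}).ConnectedComponent +
        Nat.card (fromEdgeSet {s : Sym2 V | ∃ e, ω₁ e = false ∧ ends₁ e = s}).ConnectedComponent) +
        (Nat.card {D : (fromEdgeSet {s : Sym2 V | ∃ j, ω₂ j = true ∧ ends₂ j = s}).ConnectedComponent //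
            ¬ ∃ x, x ∉ {w : V | ¬ ∀ j, w ∈ ends₂ j → w = u ∨ w = v} ∧
              (fromEdgeSet {s : Sym2 V | ∃ j, ω₂ j = true ∧ ends₂ j = s}).connectedComponentMk x = D} +
          Nat.card {D : (fromEdgeSet {s : Sym2 V | ∃ j, ω₂ j = false ∧ ends₂ j = s}).ConnectedComponent //
            ¬ ∃ x, x ∉ {w : V | ¬ ∀ j, w ∈ ends₂ j → w = u ∨ w = v} ∧
              (fromEdgeSet {s : Sym2 V | ∃ j, ω₂ j = false ∧ ends₂ j = s}).connectedComponentMk x = D}) =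
        t + 2 * Nat.card {w : V | ¬ ∀ j, w ∈ ends₂ j → w = u ∨ w = v}).card ≤
    (univ.filter fun ω₁ : ι₁ → Bool => Sum.elim ω₁ ω₂ ∈ rSet (Sum.elim ends₁ ends₂) a b c ∧
        Nat.card (fromEdgeSet {s : Sym2 V | ∃ e, Sum.elim ω₁ ω₂ e = true ∧
          Sum.elim ends₁ ends₂ e = s}).ConnectedComponent +
        Nat.card (fromEdgeSet {s : Sym2 V | ∃ e, Sum.elim ω₁ ω₂ e = false ∧
          Sum.elim ends₁ ends₂ e = s}).ConnectedComponent = t).card := by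
  classical
  refine card_le_card fun ω₁ h => ?_
  obtain ⟨hR, hg⟩ := (mem_filter.1 h).2
  refine mem_filter.2 ⟨mem_univ _,
    mem_rSet_of_mem_rSet_inl (ω := Sum.elim ω₁ ω₂) hsep ha hb hc hO hK hR, ?_⟩
  have := grade_glued_eq_inl hsep ω₁ ω₂ hO hK
  omega

end Grades

end AntipodalR1

end Summit.CriticalPhenomena.PercolationContinuityZ3.Theorems
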